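import Summits.AtomisticToContinuum.BoseEinsteinCondensation.Theses.BECParticleIncrement

/-!
# Birth skeleton — piece `GPWindowIncrement` (stmt-AtomisticToContinuum-12323) of the split of `IncrementBound`

Route `BECParticleIncrement`, BC2-redirect of the deciding crux `IncrementBound` (stmt-12320):
`IncrementBound ⟸ GPWindowIncrement ∧ ScatteringLengthFinite ∧ StaticResponseBound ∧ BootstrapStep`
(landed glue `becParticleIncrement_stepInduction_proof`). This file is the BC3 skeleton of the piece
`GPWindowIncrement` (the BASE REGIME: the per-particle increment of `λ_max` in the Gross–Pitaevskii
window `(M+1)a ≤ g₀L` of the fixed Dirichlet cube), cut by WHAT THE MANY-BODY ASYMPTOTICS CAN REACH: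

* `stub_fewBodyRungs` (M/L-sized) — the dilute FEW-BODY limit: for every fixed `M₀`, in all large
  boxes the rungs `M ≤ M₀` have increment `≥ 1/2` (indeed `→ 1`: `M + 1 ≤ M₀ + 1` bosons in a box of
  side `L → ∞` have a unique Dirichlet ground state that is a symmetrised product of the lowest sine
  mode up to pair correlations of `L²`-mass `O(a/L)`, so `λ_max(γ_M) = M (1 - O(a/L))`). No window
  condition is needed: fixed `M`, `L → ∞` is automatically dilute. Not reachable by the GP machinery,
  whose errors are `o(1)` only as `M → ∞`.
* `stub_gpAsymptoticRungs` (XL, load-bearing) — the GP-regime Bogoliubov resolution UNIFORM in the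
  window: there is `M₀` such that for `M ≥ M₀`, `(M+1)a ≤ g₀ L`, `L ≥ L₀` the increment is `≥ 1/2`
  (depletion number `d_M = M - λ_max(γ_M) = d_Bog(Ma/L) + o(1)_{M→∞}` uniformly in `g = Ma/L ≤ g₀`,
  `d_Bog` Lipschitz on `[0, g₀]`, hence `d_{M+1} - d_M = O(a/L) + o(1) ≤ 1/2`; print: BoccatoEtAl2019Acta
  (torus, norm approximation), NamEtAl2022 / BrenneckeSchleinSchraven2022 (traps); the Dirichlet cube
  with its boundary layer of width `L/√g` is not in print).

`GPWindowIncrement_of : stub_fewBodyRungs → stub_gpAsymptoticRungs → GPWindowIncrement` is the case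
split `M < M₀` / `M₀ ≤ M` with `L₀ := max L₁ L₂` (kernel-checked below, no sorry outside the stubs).
Both stubs are stated over tree declarations only (`condensateNumber`, `scatteringLength`,
`IsRepulsiveFiniteRange`), so a prover can restate either verbatim under `Theorems/`.
-/

namespace Summit.AtomisticToContinuum.BoseEinsteinCondensation.Cruxes.IncrementBound.Birth.GPWindow

open Literature.MathematicalPhysics.QuantumManyBody.BoseGas
open Summit.AtomisticToContinuum.BoseEinsteinCondensation.Theses.BECParticleIncrement

/-- **Stub (few-body rungs, M/L).** Dilute few-body limit at FIXED particle number: for every `M₀`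
there is a box size beyond which every rung `M ≤ M₀` has increment `≥ 1/2`. [LSSY2005 Ch. 2 (dilute
limit), folklore perturbation theory of `M₀ + 1` bosons in a large Dirichlet box] -/
theorem stub_fewBodyRungs :
    ∀ v : ℝ → ENNReal, IsRepulsiveFiniteRange v → scatteringLength v ≠ ⊤ →
      ∀ M₀ : ℕ, ∃ L₀ : ℝ, ∀ L : ℝ, L₀ ≤ L → ∀ M : ℕ, M ≤ M₀ →
        condensateNumber v M L + 2⁻¹ ≤ condensateNumber v (M + 1) L := by
  sorry

/-- **Stub (GP asymptotic rungs, XL — load-bearing).** Gross–Pitaevskii-window Bogoliubov resolution,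
uniform in `g = Ma/L ≤ g₀`, with `o(1)` errors as `M → ∞`: beyond some `M₀` every rung of the window
has increment `≥ 1/2`. [BoccatoEtAl2019Acta, NamEtAl2022, BrenneckeSchleinSchraven2022, LiebSeiringer2002] -/
theorem stub_gpAsymptoticRungs :
    ∀ v : ℝ → ENNReal, IsRepulsiveFiniteRange v → scatteringLength v ≠ ⊤ →
      ∀ g₀ : ℝ, 0 < g₀ → ∃ M₀ : ℕ, ∃ L₀ : ℝ, ∀ L : ℝ, L₀ ≤ L → ∀ M : ℕ, M₀ ≤ M →
        ((M : ℝ) + 1) * (scatteringLength v).toReal ≤ g₀ * L →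
          condensateNumber v M L + 2⁻¹ ≤ condensateNumber v (M + 1) L := by
  sorry

/-- **Composition (kernel-checked).** The two stubs give the piece `GPWindowIncrement` BY NAME:
case split on `M < M₀` (few-body rungs) / `M₀ ≤ M` (GP asymptotic rungs) with `L₀ := max L₁ L₂`. -/
theorem GPWindowIncrement_of
    (hFew : ∀ v : ℝ → ENNReal, IsRepulsiveFiniteRange v → scatteringLength v ≠ ⊤ →
      ∀ M₀ : ℕ, ∃ L₀ : ℝ, ∀ L : ℝ, L₀ ≤ L → ∀ M : ℕ, M ≤ M₀ →
        condensateNumber v M L + 2⁻¹ ≤ condensateNumber v (M + 1) L)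
    (hGP : ∀ v : ℝ → ENNReal, IsRepulsiveFiniteRange v → scatteringLength v ≠ ⊤ →
      ∀ g₀ : ℝ, 0 < g₀ → ∃ M₀ : ℕ, ∃ L₀ : ℝ, ∀ L : ℝ, L₀ ≤ L → ∀ M : ℕ, M₀ ≤ M →
        ((M : ℝ) + 1) * (scatteringLength v).toReal ≤ g₀ * L →
          condensateNumber v M L + 2⁻¹ ≤ condensateNumber v (M + 1) L) :
    GPWindowIncrement := by
  intro v hv ha g₀ hg₀
  obtain ⟨M₀, L₂, h₂⟩ := hGP v hv ha g₀ hg₀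
  obtain ⟨L₁, h₁⟩ := hFew v hv ha M₀
  refine ⟨max L₁ L₂, fun L hL M hM => ?_⟩
  by_cases hcase : M₀ ≤ M
  · exact h₂ L (le_trans (le_max_right L₁ L₂) hL) M hcase hM
  · push Not at hcase
    exact h₁ L (le_trans (le_max_left L₁ L₂) hL) M hcase.le

/-- The piece, from the registered stubs. -/
theorem GPWindowIncrement_proof : GPWindowIncrement :=
  GPWindowIncrement_of stub_fewBodyRungs stub_gpAsymptoticRungs

end Summit.AtomisticToContinuum.BoseEinsteinCondensation.Cruxes.IncrementBound.Birth.GPWindow
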